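import Summits.Ventures.HSemireg.Mod4LeadingTermPinsEven

/-!
# Venture HSemireg — MOD-4 line: the EIGHTFOLD (`n = 4`) `ch(O_Z)`-shape row at its two non-self-dual pins — the tail bit decided:
# at `t = 16q₄²`: drop `2` iff `5q₄q₆ = 3q₅²`; at `t = q₄²`: drop `2` iff `125q₄³q₈ + 320q₄q₅²q₆ = 96q₅⁴ + 150q₄²q₆² + 200q₄²q₅q₇`

HONEST FRAMING. Part of the Lean index of the computation cell `pub-hsemireg` (seat w3-mod4-1 gen 14, W3 SPECIAL FIBRES; file of
record `HOME/widen/W3/MOD4-OFFSPLIT-w3mod4.md` §8 (n = 4: «drops 478 (pure middle) / 479 (generic O_Z) at the locus ab = q₄²», the row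
of THEOREM A₈) and §13.26 (c) (these two criteria by pencil + machine ×2, mod4g14/x2pins/n4_criteria.json 15/15)). ELEMENTARY LINEAR
ALGEBRA over a field ONLY (two explicit `5 × 5` triangular systems): no abelian variety, no sheaf, no Ext group, no semiregularity map;
nothing here says that HC / HC_CM / HC_AV holds; no Literature fact is declared; NO definition is introduced.

SETTING: `n = 4`, `q_0 = q_1 = q_2 = q_3 = 0`, `q_4 ≠ 0`, tail `q_5, …, q_8` arbitrary; pins `t_a = C(4,a)² q₄²`: `q₄²` (`a = 0`), `16q₄²`
(`a = 1`), `36q₄²` (`a = 2`, self-dual: drop `1` always, `Mod4LeadingTermPins`). By `Mod4LeadingTermPinsEven` (`n` even)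
`dim ker(M_f − t_a) = dim ker(T_f − μ_a)`, `μ_a = (−1)^a C(4,a) q₄`, and `T_f − μ_a` is triangular:
* **`hankelT_four_pin_one_mulVec`** — `(T_f + 4q₄)v = (5q₄v₀ − 4q₅v₁ + 6q₆v₂ − 4q₇v₃ + q₈v₄, 6q₅v₂ − 4q₆v₃ + q₇v₄, 10q₄v₂ − 4q₅v₃ + q₆v₄, q₅v₄, 5q₄v₄)`;
* **`hankelT_four_pin_zero_mulVec`** — `(T_f − q₄)v = (−4q₅v₁ + 6q₆v₂ − 4q₇v₃ + q₈v₄, −5q₄v₁ + 6q₅v₂ − 4q₆v₃ + q₇v₄, 5q₄v₂ − 4q₅v₃ + q₆v₄, −5q₄v₃ + q₅v₄, 0)`;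
* **`finrank_ker_middleM_four_pin_one_of_eq`** ∕ **`…_of_ne`** — `t = 16q₄²`: `dim ker(M_f − t) = 2` if `5q₄q₆ = 3q₅²` (kernel vectors
  `(4q₅, 5q₄, 0, 0, 0)`, `(20q₄q₇ − 12q₅q₆, 0, 10q₄q₅, 25q₄², 0)`), else `1` (`v ↦ v₁` is injective on the kernel);
* **`finrank_ker_middleM_four_pin_zero_of_eq`** ∕ **`…_of_ne`** — `t = q₄²`: `dim ker(M_f − t) = 2` if
  `125q₄³q₈ + 320q₄q₅²q₆ = 96q₅⁴ + 150q₄²q₆² + 200q₄²q₅q₇` (kernel vectors `e₀` and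
  `(0, 24q₅³ − 50q₄q₅q₆ + 25q₄²q₇, 20q₄q₅² − 25q₄²q₆, 25q₄²q₅, 125q₄³)`), else `1` (`v ↦ v₀` injective: eliminating `v₁, v₂, v₃` from the
  four non-trivial rows leaves `P₀ · v₄ = 0`).
With FILE 13's `finrank_S_weilType_middle` (`r_4 = 5`) the EIGHTFOLD `ch(O_Z)`-shape middle entry is therefore `478` or `479` at `q₄²` and
at `16q₄²` EXACTLY according to these two polynomial conditions on `ch₄, …, ch₈`, `479` at `36q₄²`, `480` off the pins — so the Euler pin
value `R(−1) ∈ {48, 49, 50}` of THEOREM A₈'s row is decided by the object's Chern character. Everything PROVED, 0 sorry.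
Namespace `Summit.Ventures.HSemireg.Mod4`.
References: [BourbakiAlgebre1a3] Ch. III §8; [BuchweitzFlenner2008HH] Prop. 6.4.4 (why these matrices).
-/

namespace Summit.Ventures.HSemireg.Mod4

open Finset Matrix

variable {K : Type*} [Field K]

section PinOne

/-- **`(T_f + 4q₄) v` at `n = 4`** for `q_0 = ⋯ = q_3 = 0` (pin `a = 1`, `μ_1 = −4q₄`). [cite: BourbakiAlgebre1a3, Ch. III §8] -/
theorem hankelT_four_pin_one_mulVec {q : ℕ → K} (hq0 : q 0 = 0) (hq1 : q 1 = 0) (hq2 : q 2 = 0) (hq3 : q 3 = 0)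
    (v : Fin 5 → K) :
    (hankelT 4 q - (-(4 * q 4)) • (1 : Matrix (Fin 5) (Fin 5) K)) *ᵥ v =
      ![5 * q 4 * v 0 - 4 * q 5 * v 1 + 6 * q 6 * v 2 - 4 * q 7 * v 3 + q 8 * v 4,
        6 * q 5 * v 2 - 4 * q 6 * v 3 + q 7 * v 4,
        10 * q 4 * v 2 - 4 * q 5 * v 3 + q 6 * v 4,
        q 5 * v 4,
        5 * q 4 * v 4] := by
  have h42 : Nat.choose 4 2 = 6 := by decide
  ext i
  fin_cases i
  · simp [hankelT, Matrix.mulVec, dotProduct, Fin.sum_univ_five, Matrix.one_apply, h42]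
    ring
  · simp [hankelT, Matrix.mulVec, dotProduct, Fin.sum_univ_five, Matrix.one_apply, hq3, h42]
    ring
  · simp [hankelT, Matrix.mulVec, dotProduct, Fin.sum_univ_five, Matrix.one_apply, hq2, hq3, h42]
    ring
  · simp [hankelT, Matrix.mulVec, dotProduct, Fin.sum_univ_five, Matrix.one_apply, hq1, hq2, hq3]
    ring
  · simp [hankelT, Matrix.mulVec, dotProduct, Fin.sum_univ_five, Matrix.one_apply, hq0, hq1, hq2, hq3,
      -mul_eq_mul_right_iff, -mul_eq_zero]
    ring

/-- the kernel of `T_f + 4q₄` at `n = 4` (`q_0 = ⋯ = q_3 = 0`, `q_4 ≠ 0`, `t = 16q₄²`): transfer from `M_f`, membership, bounds. -/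
theorem ker_hankelT_four_pin_one_aux [CharZero K] {q : ℕ → K} (hq0 : q 0 = 0) (hq1 : q 1 = 0) (hq2 : q 2 = 0)
    (hq3 : q 3 = 0) (hq4 : q 4 ≠ 0) {t : K} (ht : t = 16 * (q 4 * q 4)) :
    (Module.finrank K ↥(LinearMap.ker (Matrix.toLin' (middleM 4 q) - t • LinearMap.id)) =
        Module.finrank K ↥(LinearMap.ker (Matrix.toLin' (hankelT 4 q) - (-(4 * q 4)) • LinearMap.id))) ∧
      (∀ v : Fin 5 → K, v ∈ LinearMap.ker (Matrix.toLin' (hankelT 4 q) - (-(4 * q 4)) • LinearMap.id) ↔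
        (5 * q 4 * v 0 - 4 * q 5 * v 1 + 6 * q 6 * v 2 - 4 * q 7 * v 3 + q 8 * v 4 = 0 ∧
          6 * q 5 * v 2 - 4 * q 6 * v 3 + q 7 * v 4 = 0 ∧ 10 * q 4 * v 2 - 4 * q 5 * v 3 + q 6 * v 4 = 0 ∧
          q 5 * v 4 = 0 ∧ 5 * q 4 * v 4 = 0)) ∧
      1 ≤ Module.finrank K ↥(LinearMap.ker (Matrix.toLin' (hankelT 4 q) - (-(4 * q 4)) • LinearMap.id)) ∧
      Module.finrank K ↥(LinearMap.ker (Matrix.toLin' (hankelT 4 q) - (-(4 * q 4)) • LinearMap.id)) ≤ 2 := by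
  have hq0' : ∀ m, m < 4 → q m = 0 := by
    intro m hm
    interval_cases m
    · exact hq0
    · exact hq1
    · exact hq2
    · exact hq3
  have hpin : t = (-1 : K) ^ 4 * (((4 : ℕ).choose 1 : K) * ((4 : ℕ).choose 1 : K)) * (q 4 * q 4) := by
    rw [ht]; norm_num
  have hμ : -(4 * q 4) = (-1 : K) ^ 1 * (((4 : ℕ).choose 1 : K)) * q 4 := by norm_num
  have heven : Even 4 := ⟨2, rfl⟩
  have heq := finrank_ker_middleM_leading_pin_even heven hq0' hq4 (a := 1) (by omega) hμ hpin
  refine ⟨heq, fun v => ?_, ?_, ?_⟩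
  · rw [toLin'_sub_smul_id, LinearMap.mem_ker, Matrix.toLin'_apply, hankelT_four_pin_one_mulVec hq0 hq1 hq2 hq3]
    constructor
    · intro h
      exact ⟨by simpa using congr_fun h 0, by simpa using congr_fun h 1, by simpa using congr_fun h 2,
        by simpa using congr_fun h 3, by simpa using congr_fun h 4⟩
    · rintro ⟨h0, h1, h2, h3, h4⟩
      ext i
      fin_cases i
      · exact h0
      · exact h1
      · exact h2
      · exact h3
      · exact h4
  · rw [← heq]
    exact one_le_finrank_ker_middleM_leading_pin hq0' (by omega) hpin
  · rw [← heq]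
    exact finrank_ker_middleM_leading_pin_le_two hq0' hq4 (by omega) hpin

/-- **EIGHTFOLD pin `16q₄²`, degenerate side:** `q_0 = ⋯ = q_3 = 0`, `q_4 ≠ 0`, `t = 16q₄²`, `5q₄q₆ = 3q₅²` ⇒ `dim ker(M_f − t) = 2`
(the middle entry drops to `478`). [cite: BourbakiAlgebre1a3, Ch. III §8] [cite: BuchweitzFlenner2008HH, Prop. 6.4.4] -/
theorem finrank_ker_middleM_four_pin_one_of_eq [CharZero K] {q : ℕ → K} (hq0 : q 0 = 0) (hq1 : q 1 = 0) (hq2 : q 2 = 0)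
    (hq3 : q 3 = 0) (hq4 : q 4 ≠ 0) {t : K} (ht : t = 16 * (q 4 * q 4)) (hc : 5 * q 4 * q 6 = 3 * (q 5 * q 5)) :
    Module.finrank K ↥(LinearMap.ker (Matrix.toLin' (middleM 4 q) - t • LinearMap.id)) = 2 := by
  obtain ⟨heq, hmem, -, hle2⟩ := ker_hankelT_four_pin_one_aux hq0 hq1 hq2 hq3 hq4 ht
  rw [heq]
  refine le_antisymm hle2 ?_
  set W := LinearMap.ker (Matrix.toLin' (hankelT 4 q) - (-(4 * q 4)) • LinearMap.id) with hW
  have a0 : 5 * q 4 * (4 * q 5) - 4 * q 5 * (5 * q 4) + 6 * q 6 * 0 - 4 * q 7 * 0 + q 8 * 0 = (0 : K) := by ring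
  have hu1 : (![4 * q 5, 5 * q 4, 0, 0, 0] : Fin 5 → K) ∈ W :=
    (hmem _).mpr ⟨by simpa using a0, by simp, by simp, by simp, by simp⟩
  have b0 : 5 * q 4 * (20 * q 4 * q 7 - 12 * q 5 * q 6) - 4 * q 5 * 0 + 6 * q 6 * (10 * q 4 * q 5) -
      4 * q 7 * (25 * (q 4 * q 4)) + q 8 * 0 = (0 : K) := by ring
  have b1 : 6 * q 5 * (10 * q 4 * q 5) - 4 * q 6 * (25 * (q 4 * q 4)) + q 7 * 0 = (0 : K) := by linear_combination (20 * q 4) * hc.symm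
  have b2 : 10 * q 4 * (10 * q 4 * q 5) - 4 * q 5 * (25 * (q 4 * q 4)) + q 6 * 0 = (0 : K) := by ring
  have hu2 : (![20 * q 4 * q 7 - 12 * q 5 * q 6, 0, 10 * q 4 * q 5, 25 * (q 4 * q 4), 0] : Fin 5 → K) ∈ W :=
    (hmem _).mpr ⟨by simpa using b0, by simpa using b1, by simpa using b2, by simp, by simp⟩
  have hli0 : LinearIndependent K ![(![4 * q 5, 5 * q 4, 0, 0, 0] : Fin 5 → K),
      ![20 * q 4 * q 7 - 12 * q 5 * q 6, 0, 10 * q 4 * q 5, 25 * (q 4 * q 4), 0]] := by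
    rw [LinearIndependent.pair_iff]
    intro s r hsr
    have e1 : s * (5 * q 4) = 0 := by simpa using congr_fun hsr 1
    have e3 : r * (25 * (q 4 * q 4)) = 0 := by simpa using congr_fun hsr 3
    constructor
    · rcases mul_eq_zero.mp e1 with h | h
      · exact h
      · exact absurd h (mul_ne_zero (by norm_num) hq4)
    · rcases mul_eq_zero.mp e3 with h | h
      · exact h
      · exact absurd h (mul_ne_zero (by norm_num) (mul_ne_zero hq4 hq4))
  have hli : LinearIndependent K ![(⟨_, hu1⟩ : ↥W), ⟨_, hu2⟩] := by
    refine LinearIndependent.of_comp W.subtype ?_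
    convert hli0 using 1
    funext i
    fin_cases i <;> rfl
  have h := hli.fintype_card_le_finrank
  rwa [Fintype.card_fin] at h

/-- **EIGHTFOLD pin `16q₄²`, generic side:** `q_0 = ⋯ = q_3 = 0`, `q_4 ≠ 0`, `t = 16q₄²`, `5q₄q₆ ≠ 3q₅²` ⇒ `dim ker(M_f − t) = 1`
(the middle entry drops to `479`). [cite: BourbakiAlgebre1a3, Ch. III §8] [cite: BuchweitzFlenner2008HH, Prop. 6.4.4] -/
theorem finrank_ker_middleM_four_pin_one_of_ne [CharZero K] {q : ℕ → K} (hq0 : q 0 = 0) (hq1 : q 1 = 0) (hq2 : q 2 = 0)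
    (hq3 : q 3 = 0) (hq4 : q 4 ≠ 0) {t : K} (ht : t = 16 * (q 4 * q 4)) (hc : 5 * q 4 * q 6 ≠ 3 * (q 5 * q 5)) :
    Module.finrank K ↥(LinearMap.ker (Matrix.toLin' (middleM 4 q) - t • LinearMap.id)) = 1 := by
  obtain ⟨heq, hmem, hge1, -⟩ := ker_hankelT_four_pin_one_aux hq0 hq1 hq2 hq3 hq4 ht
  rw [heq]
  refine le_antisymm ?_ hge1
  set W := LinearMap.ker (Matrix.toLin' (hankelT 4 q) - (-(4 * q 4)) • LinearMap.id) with hW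
  let f : ↥W →ₗ[K] K := (LinearMap.proj (1 : Fin 5)) ∘ₗ W.subtype
  have hf : Function.Injective f := by
    rw [← LinearMap.ker_eq_bot, LinearMap.ker_eq_bot']
    intro v hv
    have hv1 : (v : Fin 5 → K) 1 = 0 := by simpa [f] using hv
    obtain ⟨e0, e1, e2, -, e4⟩ := (hmem v).mp v.2
    have hv4 : (v : Fin 5 → K) 4 = 0 := by
      rcases mul_eq_zero.mp e4 with h | h
      · exact absurd h (mul_ne_zero (by norm_num) hq4)
      · exact h
    have hv3 : (v : Fin 5 → K) 3 = 0 := by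
      have h : (4 * (5 * q 4 * q 6 - 3 * (q 5 * q 5))) * (v : Fin 5 → K) 3 = 0 := by
        linear_combination (-5 * q 4) * e1 + (3 * q 5) * e2 + (5 * q 4 * q 7 - 3 * q 5 * q 6) * hv4
      rcases mul_eq_zero.mp h with h | h
      · exact absurd (sub_eq_zero.mp ((mul_eq_zero.mp h).resolve_left (by norm_num))) hc
      · exact h
    have hv2 : (v : Fin 5 → K) 2 = 0 := by
      rw [hv3, hv4, mul_zero, mul_zero, sub_zero, add_zero] at e2
      rcases mul_eq_zero.mp e2 with h | h
      · exact absurd h (mul_ne_zero (by norm_num) hq4)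
      · exact h
    have hv0 : (v : Fin 5 → K) 0 = 0 := by
      rw [hv1, hv2, hv3, hv4, mul_zero, mul_zero, mul_zero, mul_zero, sub_zero, add_zero, sub_zero, add_zero] at e0
      rcases mul_eq_zero.mp e0 with h | h
      · exact absurd h (mul_ne_zero (by norm_num) hq4)
      · exact h
    apply Subtype.ext
    ext i
    fin_cases i
    · exact hv0
    · exact hv1
    · exact hv2
    · exact hv3
    · exact hv4
  have h := LinearMap.finrank_le_finrank_of_injective hf
  rwa [Module.finrank_self] at h

end PinOne

section PinZero

/-- **`(T_f − q₄) v` at `n = 4`** for `q_0 = ⋯ = q_3 = 0` (pin `a = 0`, `μ_0 = q₄`). [cite: BourbakiAlgebre1a3, Ch. III §8] -/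
theorem hankelT_four_pin_zero_mulVec {q : ℕ → K} (hq0 : q 0 = 0) (hq1 : q 1 = 0) (hq2 : q 2 = 0) (hq3 : q 3 = 0)
    (v : Fin 5 → K) :
    (hankelT 4 q - q 4 • (1 : Matrix (Fin 5) (Fin 5) K)) *ᵥ v =
      ![-4 * q 5 * v 1 + 6 * q 6 * v 2 - 4 * q 7 * v 3 + q 8 * v 4,
        -5 * q 4 * v 1 + 6 * q 5 * v 2 - 4 * q 6 * v 3 + q 7 * v 4,
        5 * q 4 * v 2 - 4 * q 5 * v 3 + q 6 * v 4,
        -5 * q 4 * v 3 + q 5 * v 4,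
        0] := by
  have h42 : Nat.choose 4 2 = 6 := by decide
  ext i
  fin_cases i
  · simp [hankelT, Matrix.mulVec, dotProduct, Fin.sum_univ_five, Matrix.one_apply, h42]
    ring
  · simp [hankelT, Matrix.mulVec, dotProduct, Fin.sum_univ_five, Matrix.one_apply, hq3, h42]
    ring
  · simp [hankelT, Matrix.mulVec, dotProduct, Fin.sum_univ_five, Matrix.one_apply, hq2, hq3, h42]
    ring
  · simp [hankelT, Matrix.mulVec, dotProduct, Fin.sum_univ_five, Matrix.one_apply, hq1, hq2, hq3]
    ring
  · simp [hankelT, Matrix.mulVec, dotProduct, Fin.sum_univ_five, Matrix.one_apply, hq0, hq1, hq2, hq3,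
      -mul_eq_mul_right_iff, -mul_eq_zero]
    ring

/-- the kernel of `T_f − q₄` at `n = 4` (`q_0 = ⋯ = q_3 = 0`, `q_4 ≠ 0`, `t = q₄²`): transfer from `M_f`, membership, bounds. -/
theorem ker_hankelT_four_pin_zero_aux [CharZero K] {q : ℕ → K} (hq0 : q 0 = 0) (hq1 : q 1 = 0) (hq2 : q 2 = 0)
    (hq3 : q 3 = 0) (hq4 : q 4 ≠ 0) {t : K} (ht : t = q 4 * q 4) :
    (Module.finrank K ↥(LinearMap.ker (Matrix.toLin' (middleM 4 q) - t • LinearMap.id)) =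
        Module.finrank K ↥(LinearMap.ker (Matrix.toLin' (hankelT 4 q) - q 4 • LinearMap.id))) ∧
      (∀ v : Fin 5 → K, v ∈ LinearMap.ker (Matrix.toLin' (hankelT 4 q) - q 4 • LinearMap.id) ↔
        (-4 * q 5 * v 1 + 6 * q 6 * v 2 - 4 * q 7 * v 3 + q 8 * v 4 = 0 ∧
          -5 * q 4 * v 1 + 6 * q 5 * v 2 - 4 * q 6 * v 3 + q 7 * v 4 = 0 ∧ 5 * q 4 * v 2 - 4 * q 5 * v 3 + q 6 * v 4 = 0 ∧
          -5 * q 4 * v 3 + q 5 * v 4 = 0)) ∧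
      1 ≤ Module.finrank K ↥(LinearMap.ker (Matrix.toLin' (hankelT 4 q) - q 4 • LinearMap.id)) ∧
      Module.finrank K ↥(LinearMap.ker (Matrix.toLin' (hankelT 4 q) - q 4 • LinearMap.id)) ≤ 2 := by
  have hq0' : ∀ m, m < 4 → q m = 0 := by
    intro m hm
    interval_cases m
    · exact hq0
    · exact hq1
    · exact hq2
    · exact hq3
  have hpin : t = (-1 : K) ^ 4 * (((4 : ℕ).choose 0 : K) * ((4 : ℕ).choose 0 : K)) * (q 4 * q 4) := by
    rw [ht]; norm_num
  have hμ : q 4 = (-1 : K) ^ 0 * (((4 : ℕ).choose 0 : K)) * q 4 := by norm_num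
  have heven : Even 4 := ⟨2, rfl⟩
  have heq := finrank_ker_middleM_leading_pin_even heven hq0' hq4 (a := 0) (by omega) hμ hpin
  refine ⟨heq, fun v => ?_, ?_, ?_⟩
  · rw [toLin'_sub_smul_id, LinearMap.mem_ker, Matrix.toLin'_apply, hankelT_four_pin_zero_mulVec hq0 hq1 hq2 hq3]
    constructor
    · intro h
      exact ⟨by simpa using congr_fun h 0, by simpa using congr_fun h 1, by simpa using congr_fun h 2,
        by simpa using congr_fun h 3⟩
    · rintro ⟨h0, h1, h2, h3⟩
      ext i
      fin_cases i
      · exact h0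
      · exact h1
      · exact h2
      · exact h3
      · rfl
  · rw [← heq]
    exact one_le_finrank_ker_middleM_leading_pin hq0' (by omega) hpin
  · rw [← heq]
    exact finrank_ker_middleM_leading_pin_le_two hq0' hq4 (by omega) hpin

/-- **EIGHTFOLD pin `q₄²`, degenerate side:** `q_0 = ⋯ = q_3 = 0`, `q_4 ≠ 0`, `t = q₄²` and
`125q₄³q₈ + 320q₄q₅²q₆ = 96q₅⁴ + 150q₄²q₆² + 200q₄²q₅q₇` ⇒ `dim ker(M_f − t) = 2` (the middle entry drops to `478`; the pure shape
`q₅ = ⋯ = q₈ = 0` is included). [cite: BourbakiAlgebre1a3, Ch. III §8] [cite: BuchweitzFlenner2008HH, Prop. 6.4.4] -/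
theorem finrank_ker_middleM_four_pin_zero_of_eq [CharZero K] {q : ℕ → K} (hq0 : q 0 = 0) (hq1 : q 1 = 0) (hq2 : q 2 = 0)
    (hq3 : q 3 = 0) (hq4 : q 4 ≠ 0) {t : K} (ht : t = q 4 * q 4)
    (hc : 125 * q 4 ^ 3 * q 8 + 320 * q 4 * q 5 ^ 2 * q 6 = 96 * q 5 ^ 4 + 150 * q 4 ^ 2 * q 6 ^ 2 + 200 * q 4 ^ 2 * q 5 * q 7) :
    Module.finrank K ↥(LinearMap.ker (Matrix.toLin' (middleM 4 q) - t • LinearMap.id)) = 2 := by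
  obtain ⟨heq, hmem, -, hle2⟩ := ker_hankelT_four_pin_zero_aux hq0 hq1 hq2 hq3 hq4 ht
  rw [heq]
  refine le_antisymm hle2 ?_
  set W := LinearMap.ker (Matrix.toLin' (hankelT 4 q) - q 4 • LinearMap.id) with hW
  have hu1 : (![1, 0, 0, 0, 0] : Fin 5 → K) ∈ W := (hmem _).mpr ⟨by simp, by simp, by simp, by simp⟩
  have b0 : -4 * q 5 * (24 * q 5 ^ 3 - 50 * q 4 * q 5 * q 6 + 25 * q 4 ^ 2 * q 7) +
      6 * q 6 * (20 * q 4 * q 5 ^ 2 - 25 * q 4 ^ 2 * q 6) - 4 * q 7 * (25 * q 4 ^ 2 * q 5) + q 8 * (125 * q 4 ^ 3) = (0 : K) := by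
    linear_combination hc
  have b1 : -5 * q 4 * (24 * q 5 ^ 3 - 50 * q 4 * q 5 * q 6 + 25 * q 4 ^ 2 * q 7) +
      6 * q 5 * (20 * q 4 * q 5 ^ 2 - 25 * q 4 ^ 2 * q 6) - 4 * q 6 * (25 * q 4 ^ 2 * q 5) + q 7 * (125 * q 4 ^ 3) = (0 : K) := by
    ring
  have b2 : 5 * q 4 * (20 * q 4 * q 5 ^ 2 - 25 * q 4 ^ 2 * q 6) - 4 * q 5 * (25 * q 4 ^ 2 * q 5) + q 6 * (125 * q 4 ^ 3) = (0 : K) := by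
    ring
  have b3 : -5 * q 4 * (25 * q 4 ^ 2 * q 5) + q 5 * (125 * q 4 ^ 3) = (0 : K) := by ring
  have hu2 : (![0, 24 * q 5 ^ 3 - 50 * q 4 * q 5 * q 6 + 25 * q 4 ^ 2 * q 7, 20 * q 4 * q 5 ^ 2 - 25 * q 4 ^ 2 * q 6,
      25 * q 4 ^ 2 * q 5, 125 * q 4 ^ 3] : Fin 5 → K) ∈ W :=
    (hmem _).mpr ⟨by simpa using b0, by simpa using b1, by simpa using b2, by simpa using b3⟩
  have hli0 : LinearIndependent K ![(![1, 0, 0, 0, 0] : Fin 5 → K),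
      ![0, 24 * q 5 ^ 3 - 50 * q 4 * q 5 * q 6 + 25 * q 4 ^ 2 * q 7, 20 * q 4 * q 5 ^ 2 - 25 * q 4 ^ 2 * q 6,
        25 * q 4 ^ 2 * q 5, 125 * q 4 ^ 3]] := by
    rw [LinearIndependent.pair_iff]
    intro s r hsr
    have e0 : s = 0 := by simpa using congr_fun hsr 0
    have e4 : r * (125 * q 4 ^ 3) = 0 := by simpa using congr_fun hsr 4
    refine ⟨e0, ?_⟩
    rcases mul_eq_zero.mp e4 with h | h
    · exact h
    · exact absurd h (mul_ne_zero (by norm_num) (pow_ne_zero 3 hq4))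
  have hli : LinearIndependent K ![(⟨_, hu1⟩ : ↥W), ⟨_, hu2⟩] := by
    refine LinearIndependent.of_comp W.subtype ?_
    convert hli0 using 1
    funext i
    fin_cases i <;> rfl
  have h := hli.fintype_card_le_finrank
  rwa [Fintype.card_fin] at h

/-- **EIGHTFOLD pin `q₄²`, generic side:** `q_0 = ⋯ = q_3 = 0`, `q_4 ≠ 0`, `t = q₄²` and
`125q₄³q₈ + 320q₄q₅²q₆ ≠ 96q₅⁴ + 150q₄²q₆² + 200q₄²q₅q₇` ⇒ `dim ker(M_f − t) = 1` (the middle entry drops to `479`): eliminating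
`v₁, v₂, v₃` from the rows `1, 2, 3` of `(T_f − q₄)v = 0` in row `0` leaves `P₀ · v₄ = 0`. [cite: BourbakiAlgebre1a3, Ch. III §8]
[cite: BuchweitzFlenner2008HH, Prop. 6.4.4] -/
theorem finrank_ker_middleM_four_pin_zero_of_ne [CharZero K] {q : ℕ → K} (hq0 : q 0 = 0) (hq1 : q 1 = 0) (hq2 : q 2 = 0)
    (hq3 : q 3 = 0) (hq4 : q 4 ≠ 0) {t : K} (ht : t = q 4 * q 4)
    (hc : 125 * q 4 ^ 3 * q 8 + 320 * q 4 * q 5 ^ 2 * q 6 ≠ 96 * q 5 ^ 4 + 150 * q 4 ^ 2 * q 6 ^ 2 + 200 * q 4 ^ 2 * q 5 * q 7) :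
    Module.finrank K ↥(LinearMap.ker (Matrix.toLin' (middleM 4 q) - t • LinearMap.id)) = 1 := by
  obtain ⟨heq, hmem, hge1, -⟩ := ker_hankelT_four_pin_zero_aux hq0 hq1 hq2 hq3 hq4 ht
  rw [heq]
  refine le_antisymm ?_ hge1
  set W := LinearMap.ker (Matrix.toLin' (hankelT 4 q) - q 4 • LinearMap.id) with hW
  let f : ↥W →ₗ[K] K := (LinearMap.proj (0 : Fin 5)) ∘ₗ W.subtype
  have hf : Function.Injective f := by
    rw [← LinearMap.ker_eq_bot, LinearMap.ker_eq_bot']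
    intro v hv
    have hv0 : (v : Fin 5 → K) 0 = 0 := by simpa [f] using hv
    obtain ⟨e0, e1, e2, e3⟩ := (hmem v).mp v.2
    have hv4 : (v : Fin 5 → K) 4 = 0 := by
      have h : (125 * q 4 ^ 3 * q 8 + 320 * q 4 * q 5 ^ 2 * q 6 -
          (96 * q 5 ^ 4 + 150 * q 4 ^ 2 * q 6 ^ 2 + 200 * q 4 ^ 2 * q 5 * q 7)) * (v : Fin 5 → K) 4 = 0 := by
        linear_combination (125 * q 4 ^ 3) * e0 + (-100 * q 4 ^ 2 * q 5) * e1 +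
          (120 * q 4 * q 5 ^ 2 - 150 * q 4 ^ 2 * q 6) * e2 + (-100 * q 4 ^ 2 * q 7 + 200 * q 4 * q 5 * q 6 - 96 * q 5 ^ 3) * e3
      rcases mul_eq_zero.mp h with h | h
      · exact absurd (sub_eq_zero.mp h) hc
      · exact h
    have hv3 : (v : Fin 5 → K) 3 = 0 := by
      rw [hv4, mul_zero, add_zero] at e3
      rcases mul_eq_zero.mp e3 with h | h
      · exact absurd h (mul_ne_zero (by norm_num) hq4)
      · exact h
    have hv2 : (v : Fin 5 → K) 2 = 0 := by
      rw [hv3, hv4, mul_zero, mul_zero, sub_zero, add_zero] at e2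
      rcases mul_eq_zero.mp e2 with h | h
      · exact absurd h (mul_ne_zero (by norm_num) hq4)
      · exact h
    have hv1 : (v : Fin 5 → K) 1 = 0 := by
      rw [hv2, hv3, hv4, mul_zero, mul_zero, mul_zero, add_zero, sub_zero, add_zero] at e1
      rcases mul_eq_zero.mp e1 with h | h
      · exact absurd h (mul_ne_zero (by norm_num) hq4)
      · exact h
    apply Subtype.ext
    ext i
    fin_cases i
    · exact hv0
    · exact hv1
    · exact hv2
    · exact hv3
    · exact hv4
  have h := LinearMap.finrank_le_finrank_of_injective hf
  rwa [Module.finrank_self] at h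

end PinZero

end Summit.Ventures.HSemireg.Mod4
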